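import Summits.ValiantsHypothesis.ValiantsHypothesis.Theorems.KPlusLogSqLawStaticPathSweep

/-!
# Route «KPlusLogSqLaw» — parametric max-weight independent set on a path: an event changes the SIZE of the optimum iff its indices have opposite parity

HONEST FRAMING.  Helper toward the crux `WeakLifting` (item `stmt-ValiantsHypothesis-19561`, route `KPlusLogSqLaw`, cell `pub-symmetroid`,
seat val-sym-lift-p4 g21, 2026-08-29) on the line of its witness-plan stub `stub_tridiagonalSectorB` (tropical twin of the STATIC tridiagonal
sector = parametric maximum-weight independent set on a path).  Sequel of `…StaticPathEvents` (`toggle_ends_of_ne`: across an event `(α, κ)` the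
two end positions change their uncovered-status and no other position does) toward THEOREM T in the optimum's own currency
(`…StaticPathMixedEvents.mixedEvents_card_le`, val-sym-lift-p4 g14/g20: at most `2n` MIXED events).  Here:
(1) `sum_neg_one_pow_covered` — for every independent subset `M` of the block `i+1, …, i+n` the SIGNED count of covered positions vanishes,
`Σ_{x ≤ n} (-1)^x · [x covered] = 0` (each item covers two consecutive positions); (2) `two_mul_card_eq_card_covered` — twice `|M|` is the number of
covered positions; (3) **`card_eq_card_iff_even_of_ne`** — across an adjacent transposition `(α, κ)` of the prefix-sum lines at which the unique
optimum changes, the optimum KEEPS ITS SIZE iff `α ≡ κ (mod 2)` (a vacancy hops from one end to the other), and changes it by one iff `α + κ` is odd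
(a pair of vacancies is created or annihilated at the two ends) — so the MIXED events are exactly the changes of `|optimum|` (the sweep with
sizes and the bound «`|optimum|` changes at most `2n` times along any generic sweep» follow in `…StaticPathSizeChanges`).  Statements about a path
DP; nothing here asserts anything about `WeakLifting`, `TropicalB`, `KPlusLogSqLaw`, the stub in its window, `MatrixDescartes`
(stmt-ValiantsHypothesis-18050) or `VP ≠ VNP`; the same-parity events («hops») and the ORDER QUESTION stay open.
-/

set_option linter.dupNamespace false
set_option autoImplicit false

namespace Summit.ValiantsHypothesis.ValiantsHypothesis.Theorems.KPlusLogSqLaw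

open Finset Classical

namespace StaticPathFold

noncomputable section

/-! ## 1. Covered positions: the signed count vanishes, the plain count is twice the size -/

section Covered

/-- **the signed count of covered positions vanishes**: for an independent subset `M` of the block `i+1, …, i+n`,
`Σ_{x ≤ n} (-1)^x · [position x covered by M] = 0` — item `t` covers the two consecutive positions `t-i-1`, `t-i`. [folklore] -/
theorem sum_neg_one_pow_covered {i n : ℕ} {M : Finset ℕ} (hM : M ∈ indepSets i n) :
    ∑ x ∈ range (n + 1), (if (i + x ∉ M ∧ i + x + 1 ∉ M) then (0 : ℤ) else (-1) ^ x) = 0 := by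
  rcases mem_indepSets.mp hM with ⟨hM1, hM2⟩
  have hbd : ∀ t ∈ M, i + 1 ≤ t ∧ t ≤ i + n := fun t ht => by have := mem_Ioc.mp (hM1 ht); omega
  -- split the indicator of «covered»: the two covering events exclude each other
  have hsplit : ∀ x, (if (i + x ∉ M ∧ i + x + 1 ∉ M) then (0 : ℤ) else (-1) ^ x)
      = (if i + x ∈ M then ((-1 : ℤ) ^ x) else 0) + (if i + x + 1 ∈ M then ((-1 : ℤ) ^ x) else 0) := by
    intro x
    by_cases h1 : i + x ∈ M
    · have h2 : i + x + 1 ∉ M := hM2 _ h1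
      simp [h1, h2]
    · by_cases h2 : i + x + 1 ∈ M
      · simp [h1, h2]
      · simp [h1, h2]
  rw [sum_congr rfl (fun x _ => hsplit x), sum_add_distrib,
    sum_range_succ' (fun x => if i + x ∈ M then ((-1 : ℤ) ^ x) else 0),
    sum_range_succ (fun x => if i + x + 1 ∈ M then ((-1 : ℤ) ^ x) else 0)]
  have h0 : i + 0 ∉ M := fun h => by have := hbd _ h; omega
  have hn : i + n + 1 ∉ M := fun h => by have := hbd _ h; omega
  rw [if_neg h0, if_neg hn, add_zero, add_zero, ← sum_add_distrib]
  apply sum_eq_zero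
  intro x _
  by_cases h : i + x + 1 ∈ M
  · rw [show i + (x + 1) = i + x + 1 from (Nat.add_assoc i x 1).symm, if_pos h, if_pos h, pow_succ]; ring
  · rw [show i + (x + 1) = i + x + 1 from (Nat.add_assoc i x 1).symm, if_neg h, if_neg h, add_zero]

/-- **twice the size is the number of covered positions** (the parity invariant `card_uncovered_add` read on the covered side). [folklore] -/
theorem two_mul_card_eq_card_covered {i n : ℕ} {M : Finset ℕ} (hM : M ∈ indepSets i n) :
    2 * M.card = ((range (n + 1)).filter (fun x => ¬ (i + x ∉ M ∧ i + x + 1 ∉ M))).card := by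
  have h1 := card_uncovered_add hM
  have h2 := Finset.card_filter_add_card_filter_not (s := range (n + 1)) (fun x => i + x ∉ M ∧ i + x + 1 ∉ M)
  rw [card_range] at h2
  omega

end Covered

/-! ## 2. Signs: `(-1)^α` against `(-1)^κ` -/

section Signs

/-- `(-1)^α = (-1)^κ` forces `α + κ` even. [folklore] -/
theorem even_add_of_neg_one_pow_eq {α κ : ℕ} (h : ((-1 : ℤ)) ^ α = (-1) ^ κ) : Even (α + κ) := by
  have hκ2 : ((-1 : ℤ) ^ κ) * (-1) ^ κ = 1 := by rw [← pow_add, Even.neg_one_pow ⟨κ, rfl⟩]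
  rcases Nat.even_or_odd (α + κ) with he | ho
  · exact he
  · exfalso
    have h1 := Odd.neg_one_pow (α := ℤ) ho
    rw [pow_add, h, hκ2] at h1
    norm_num at h1

/-- `(-1)^α = -(-1)^κ` forces `α + κ` odd. [folklore] -/
theorem odd_add_of_neg_one_pow_eq_neg {α κ : ℕ} (h : ((-1 : ℤ)) ^ α = -(-1) ^ κ) : Odd (α + κ) := by
  have hκ2 : ((-1 : ℤ) ^ κ) * (-1) ^ κ = 1 := by rw [← pow_add, Even.neg_one_pow ⟨κ, rfl⟩]
  rcases Nat.even_or_odd (α + κ) with he | ho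
  · exfalso
    have h1 := Even.neg_one_pow (α := ℤ) he
    rw [pow_add, h, neg_mul, hκ2] at h1
    norm_num at h1
  · exact ho

end Signs

/-! ## 3. An event keeps the size of the optimum iff its two indices have the same parity -/

section Parity

variable (w₁ w₀ : ℕ → ℝ)

/-- **MIXED EVENTS ARE EXACTLY THE SIZE CHANGES.**  Across an adjacent transposition `(α, κ)`, `α < κ ≤ n`, of the prefix-sum lines of the block
`i+1, …, i+n` (all other pairs keep their order, values distinct at both parameters, no third line between `S_α` and `S_κ` at `θ`), if the unique
optimal independent set changes from `M` to `M'`, then `|M| = |M'|` iff `α + κ` is even (a vacancy hops between the two ends); equivalently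
`|M| ≠ |M'|` iff `α + κ` is odd (a pair of vacancies is created or annihilated at the two ends: `|M'| = |M| ∓ 1`). [folklore] -/
theorem card_eq_card_iff_even_of_ne {i n α κ : ℕ} {θ θ' : ℝ} {M M' : Finset ℕ} (hακ : α < κ) (hκn : κ ≤ n)
    (hM : M ∈ indepSets i n) (hM' : M' ∈ indepSets i n)
    (huniq : ∀ T ∈ indepSets i n, T ≠ M → ∑ t ∈ T, W w₁ w₀ t θ < ∑ t ∈ M, W w₁ w₀ t θ)
    (huniq' : ∀ T ∈ indepSets i n, T ≠ M' → ∑ t ∈ T, W w₁ w₀ t θ' < ∑ t ∈ M', W w₁ w₀ t θ')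
    (hord : ∀ p q, p ≤ n → q ≤ n → ¬(p = α ∧ q = κ) → ¬(p = κ ∧ q = α) →
      (L (altA (shift i w₁)) (altB (shift i w₀)) p θ < L (altA (shift i w₁)) (altB (shift i w₀)) q θ ↔
        L (altA (shift i w₁)) (altB (shift i w₀)) p θ' < L (altA (shift i w₁)) (altB (shift i w₀)) q θ'))
    (hdis : ∀ p q, p ≤ n → q ≤ n → p ≠ q → L (altA (shift i w₁)) (altB (shift i w₀)) p θ ≠ L (altA (shift i w₁)) (altB (shift i w₀)) q θ)
    (hdis' : ∀ p q, p ≤ n → q ≤ n → p ≠ q → L (altA (shift i w₁)) (altB (shift i w₀)) p θ' ≠ L (altA (shift i w₁)) (altB (shift i w₀)) q θ')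
    (hadj : ∀ x, x ≤ n → x ≠ α → x ≠ κ →
      (L (altA (shift i w₁)) (altB (shift i w₀)) x θ < L (altA (shift i w₁)) (altB (shift i w₀)) α θ ↔
        L (altA (shift i w₁)) (altB (shift i w₀)) x θ < L (altA (shift i w₁)) (altB (shift i w₀)) κ θ))
    (hne : M ≠ M') :
    M.card = M'.card ↔ Even (α + κ) := by
  obtain ⟨hα, hκ, hothers⟩ := toggle_ends_of_ne w₁ w₀ hακ hκn hM hM' huniq huniq' hord hdis hdis' hadj hne
  have hαn : α ≤ n := hακ.le.trans hκn
  have hαmem : α ∈ range (n + 1) := mem_range.mpr (by omega)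
  have hκmem : κ ∈ range (n + 1) := mem_range.mpr (by omega)
  -- (a) the signed identity: the contributions of `α` and of `κ` to `Σ (-1)^x [covered]` cancel between `M` and `M'`
  have hsgn : ((if (i + α ∉ M ∧ i + α + 1 ∉ M) then (0 : ℤ) else (-1) ^ α) -
        (if (i + α ∉ M' ∧ i + α + 1 ∉ M') then (0 : ℤ) else (-1) ^ α)) +
      ((if (i + κ ∉ M ∧ i + κ + 1 ∉ M) then (0 : ℤ) else (-1) ^ κ) -
        (if (i + κ ∉ M' ∧ i + κ + 1 ∉ M') then (0 : ℤ) else (-1) ^ κ)) = 0 := by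
    have h0 : ∑ x ∈ range (n + 1), ((if (i + x ∉ M ∧ i + x + 1 ∉ M) then (0 : ℤ) else (-1) ^ x) -
        (if (i + x ∉ M' ∧ i + x + 1 ∉ M') then (0 : ℤ) else (-1) ^ x)) = 0 := by
      rw [sum_sub_distrib, sum_neg_one_pow_covered hM, sum_neg_one_pow_covered hM', sub_zero]
    rw [sum_eq_add_of_mem α κ hαmem hκmem (ne_of_lt hακ)] at h0
    · exact h0
    · intro x hx hxne
      have e := hothers x (by have := mem_range.mp hx; omega) hxne.1 hxne.2
      by_cases h : (i + x ∉ M ∧ i + x + 1 ∉ M)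
      · rw [if_pos h, if_pos (e.mp h), sub_self]
      · rw [if_neg h, if_neg (fun h' => h (e.mpr h')), sub_self]
  -- (b) the plain identity: `2|M| - 2|M'|` is the change of the number of covered positions at `α` and at `κ`
  have hcnt : (2 * (M.card : ℤ)) - 2 * (M'.card : ℤ) =
      ((if (i + α ∉ M ∧ i + α + 1 ∉ M) then (0 : ℤ) else 1) - (if (i + α ∉ M' ∧ i + α + 1 ∉ M') then (0 : ℤ) else 1)) +
      ((if (i + κ ∉ M ∧ i + κ + 1 ∉ M) then (0 : ℤ) else 1) - (if (i + κ ∉ M' ∧ i + κ + 1 ∉ M') then (0 : ℤ) else 1)) := by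
    have e1 : (2 * (M.card : ℤ)) = ∑ x ∈ range (n + 1), (if (i + x ∉ M ∧ i + x + 1 ∉ M) then (0 : ℤ) else 1) := by
      have h := two_mul_card_eq_card_covered hM
      have h' : ∑ x ∈ range (n + 1), (if (i + x ∉ M ∧ i + x + 1 ∉ M) then (0 : ℤ) else 1) =
          ∑ x ∈ range (n + 1), (if ¬ (i + x ∉ M ∧ i + x + 1 ∉ M) then (1 : ℤ) else 0) :=
        sum_congr rfl (fun x _ => by by_cases hh : (i + x ∉ M ∧ i + x + 1 ∉ M) <;> simp [hh])
      rw [h', sum_boole]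
      exact_mod_cast h
    have e2 : (2 * (M'.card : ℤ)) = ∑ x ∈ range (n + 1), (if (i + x ∉ M' ∧ i + x + 1 ∉ M') then (0 : ℤ) else 1) := by
      have h := two_mul_card_eq_card_covered hM'
      have h' : ∑ x ∈ range (n + 1), (if (i + x ∉ M' ∧ i + x + 1 ∉ M') then (0 : ℤ) else 1) =
          ∑ x ∈ range (n + 1), (if ¬ (i + x ∉ M' ∧ i + x + 1 ∉ M') then (1 : ℤ) else 0) :=
        sum_congr rfl (fun x _ => by by_cases hh : (i + x ∉ M' ∧ i + x + 1 ∉ M') <;> simp [hh])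
      rw [h', sum_boole]
      exact_mod_cast h
    rw [e1, e2, ← sum_sub_distrib, sum_eq_add_of_mem α κ hαmem hκmem (ne_of_lt hακ)]
    intro x hx hxne
    have e := hothers x (by have := mem_range.mp hx; omega) hxne.1 hxne.2
    by_cases h : (i + x ∉ M ∧ i + x + 1 ∉ M)
    · rw [if_pos h, if_pos (e.mp h), sub_self]
    · rw [if_neg h, if_neg (fun h' => h (e.mpr h')), sub_self]
  -- (c) the four cases of the two toggles
  by_cases uα : (i + α ∉ M ∧ i + α + 1 ∉ M)
  · have uα' : ¬ (i + α ∉ M' ∧ i + α + 1 ∉ M') := fun h => hα ⟨fun _ => h, fun _ => uα⟩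
    rw [if_pos uα, if_neg uα'] at hsgn hcnt
    by_cases uκ : (i + κ ∉ M ∧ i + κ + 1 ∉ M)
    · -- both ends uncovered before, covered after: a pair annihilation, `|M'| = |M| + 1`
      have uκ' : ¬ (i + κ ∉ M' ∧ i + κ + 1 ∉ M') := fun h => hκ ⟨fun _ => h, fun _ => uκ⟩
      rw [if_pos uκ, if_neg uκ'] at hsgn hcnt
      have hodd : Odd (α + κ) := odd_add_of_neg_one_pow_eq_neg (by linear_combination -hsgn)
      constructor
      · intro h; exfalso; rw [h] at hcnt; norm_num at hcnt
      · intro h; exfalso; exact (Nat.not_even_iff_odd.mpr hodd) h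
    · -- `α` uncovered and `κ` covered before, the reverse after: a hop, same size
      have uκ' : (i + κ ∉ M' ∧ i + κ + 1 ∉ M') := by
        by_contra h; exact hκ ⟨fun h' => absurd h' uκ, fun h' => absurd h' h⟩
      rw [if_neg uκ, if_pos uκ'] at hsgn hcnt
      have heven : Even (α + κ) := even_add_of_neg_one_pow_eq (by linear_combination -hsgn)
      constructor
      · intro _; exact heven
      · intro _; have : (M.card : ℤ) = M'.card := by linarith
        exact_mod_cast this
  · have uα' : (i + α ∉ M' ∧ i + α + 1 ∉ M') := by
      by_contra h; exact hα ⟨fun h' => absurd h' uα, fun h' => absurd h' h⟩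
    rw [if_neg uα, if_pos uα'] at hsgn hcnt
    by_cases uκ : (i + κ ∉ M ∧ i + κ + 1 ∉ M)
    · -- `α` covered and `κ` uncovered before, the reverse after: a hop, same size
      have uκ' : ¬ (i + κ ∉ M' ∧ i + κ + 1 ∉ M') := fun h => hκ ⟨fun _ => h, fun _ => uκ⟩
      rw [if_pos uκ, if_neg uκ'] at hsgn hcnt
      have heven : Even (α + κ) := even_add_of_neg_one_pow_eq (by linear_combination hsgn)
      constructor
      · intro _; exact heven
      · intro _; have : (M.card : ℤ) = M'.card := by linarith
        exact_mod_cast this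
    · -- both ends covered before, uncovered after: a pair creation, `|M'| = |M| - 1`
      have uκ' : (i + κ ∉ M' ∧ i + κ + 1 ∉ M') := by
        by_contra h; exact hκ ⟨fun h' => absurd h' uκ, fun h' => absurd h' h⟩
      rw [if_neg uκ, if_pos uκ'] at hsgn hcnt
      have hodd : Odd (α + κ) := odd_add_of_neg_one_pow_eq_neg (by linear_combination hsgn)
      constructor
      · intro h; exfalso; rw [h] at hcnt; norm_num at hcnt
      · intro h; exfalso; exact (Nat.not_even_iff_odd.mpr hodd) h

end Parity

end

end StaticPathFold

end Summit.ValiantsHypothesis.ValiantsHypothesis.Theorems.KPlusLogSqLaw
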